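import Literature.NumberTheory.EllipticCurves.ModularCurveSturmProofs
import Literature.NumberTheory.EllipticCurves.ModularCurveKleinJ
import Literature.NumberTheory.DiophantineGeometry.FunctionFieldGenus
import Mathlib.RingTheory.LaurentSeries
import Mathlib.FieldTheory.PrimitiveElement
import HarnessLib

/-!
# The modular function field `K_N = ℂ(X₀(N))` inside `ℂ((q))` is an algebraic function field
  of one variable over `ℂ` (trunk EllArithM; layer 3 of the Riemann–Roch bridge to
  `dim S₂(Γ₀(N)) = g(X₀(N))`)

The modular curve `X₀(N)` as a compact Riemann surface is not available, but its function field is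
elementary: this file realises **the field of modular functions of level `Γ₀(N)`** as the
intermediate field of `ℂ((q))/ℂ` (Mathlib `LaurentSeries ℂ`) consisting of the `q`-expansions of
ratios `F/G` of modular forms `F, G ∈ M_k(Γ₀(N))` of equal weight (`modularFunctionField N`; Shimura
§2.1 `A₀(Γ)`, Diamond–Shurman §7.5 `ℂ(X(Γ))`), and proves that it is an algebraic function field of
one variable over `ℂ` with full constant field `ℂ` in the sense of the tree's Riemann–Roch
development (`DiophantineGeometry/FunctionFieldGenus`: class `IsAlgFunctionField ℂ K_N`, so that
`FunctionFieldAdelesProofs.riemann_roch_holds` applies to `K_N`):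

* `qExpansionL N F ∈ ℂ((q))` — the `q`-expansion as a Laurent series (ring-hom properties,
  `q`-expansion principle `qExpansionL_eq_zero_iff`); `ofLevelOne` — level-one forms at level `Γ`.
* `modularFunctionField N : IntermediateField ℂ (LaurentSeries ℂ)`; representations
  (`mul_eq_mul_of_repr`, `exists_repr_weight_twelve_mul`).
* `kleinJL = q-exp(E₄³)/q-exp(Δ) ∈ K_N` (`kleinJL_mem_modularFunctionField`) and
  **`j` is transcendental over `ℂ`** (`aeval_kleinJL_ne_zero`, leading `q`-coefficient).
* **The Sturm count** `exists_polynomial_relation_kleinJL`: every `u ∈ K_N` satisfies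
  `∑_{i ≤ μ} cᵢ(j) uⁱ = 0` with `cᵢ ∈ ℂ[X]` not all zero, `μ = [SL₂(ℤ) : Γ₀(N)]` — because the
  `(μ+1)(n+1)` forms `E₄^{3t}Δ^{n−t}FⁱG^{μ−i} ∈ M_{12n+μk}(Γ₀(N))` must be dependent for `n ≫ 0`
  by Sturm's dimension bound `dim M_K(Γ₀(N)) ≤ Kμ/12 + 1` (`ModularCurveSturmProofs`). Hence
  `K_N/ℂ(j)` is algebraic with all degrees `≤ μ` (`natDegree_minpoly_ratFuncJ_le`; Shimura
  Prop. 2.11), `trdeg_ℂ K_N = 1` (`trdeg_modularFunctionField`), and by a primitive-element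
  argument for bounded degrees (`exists_adjoin_simple_eq_top_of_natDegree_le`) `K_N = ℂ(j, u₀)`
  (`exists_ratFuncJ_adjoin_eq_top`).
* Instances `isAlgFunctionField_modularFunctionField : IsAlgFunctionField ℂ K_N` and
  `isIntegrallyClosedIn_modularFunctionField : IsIntegrallyClosedIn ℂ K_N`.

Everything is in `namespace Literature.ModularForms`; all statements are proved.

## References

* G. Shimura, *Introduction to the arithmetic theory of automorphic functions*, Princeton 1971,
  §2.1–2.2, Prop. 2.11.
* F. Diamond, J. Shurman, *A first course in modular forms*, GTM 228, Springer 2005, §1.2, §3.5,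
  §7.5.
* H. Stichtenoth, *Algebraic Function Fields and Codes*, 2nd ed., GTM 254, Springer 2009, Def. 1.1.1.
* J. Sturm, *On the congruence of modular forms*, LNM 1240 (1987), Thm. 1 (via `ModularCurveSturmProofs`).
-/

noncomputable section

open UpperHalfPlane hiding I
open ModularForm SlashInvariantForm ModularFormClass Complex Filter Function CongruenceSubgroup
  EisensteinSeries Polynomial
open scoped MatrixGroups Real Topology Manifold IntermediateField

namespace Literature.NumberTheory.EllipticCurves.ModularForms

/-! ### Level-one forms at level `Γ` -/

/-- A level-one modular form viewed as a modular form for a subgroup `Γ ≤ SL₂(ℤ)`. [folklore] -/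
def ofLevelOne (Γ : Subgroup SL(2, ℤ)) {k : ℤ} (f : ModularForm 𝒮ℒ k) : ModularForm Γ k where
  toFun := f
  slash_action_eq' A hA := by
    obtain ⟨γ, -, rfl⟩ := hA
    exact f.slash_action_eq' _ ⟨γ, rfl⟩
  holo' := f.holo'
  bdd_at_cusps' hc := f.bdd_at_cusps' (hc.mono fun A hA ↦ by
    obtain ⟨γ, -, rfl⟩ := hA
    exact ⟨γ, rfl⟩)

/-- `ofLevelOne` does not change the underlying function. [folklore] -/
@[simp]
theorem coe_ofLevelOne (Γ : Subgroup SL(2, ℤ)) {k : ℤ} (f : ModularForm 𝒮ℒ k) :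
    (ofLevelOne Γ f : ℍ → ℂ) = f := rfl

/-! ### `q`-expansions as Laurent series -/

variable (N : ℕ)

/-- The `q`-expansion of a modular form for `Γ₀(N)` (period `1`) as a formal Laurent series
`∑ a_n q^n ∈ ℂ((q))` (Diamond–Shurman §1.2). [folklore] -/
def qExpansionL {k : ℤ} (F : ModularForm (Gamma0 N) k) : LaurentSeries ℂ :=
  (qExpansion 1 F : PowerSeries ℂ)

/-- `qExpansionL` unfolds to the coercion of the `q`-expansion power series. [folklore] -/
theorem qExpansionL_def {k : ℤ} (F : ModularForm (Gamma0 N) k) :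
    qExpansionL N F = ((qExpansion 1 F : PowerSeries ℂ) : LaurentSeries ℂ) := rfl

/-- `qExpansionL` is multiplicative: `q`-expansion of a product of forms. [folklore] -/
theorem qExpansionL_mul {a b : ℤ} (F : ModularForm (Gamma0 N) a) (G : ModularForm (Gamma0 N) b) :
    qExpansionL N (F.mul G) = qExpansionL N F * qExpansionL N G := by
  rw [qExpansionL, qExpansionL, qExpansionL,
    ModularForm.qExpansion_mul one_pos (one_mem_strictPeriods_coe_gamma0 N), PowerSeries.coe_mul]

/-- `qExpansionL` is additive. [folklore] -/
theorem qExpansionL_add {k : ℤ} (F G : ModularForm (Gamma0 N) k) :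
    qExpansionL N (F + G) = qExpansionL N F + qExpansionL N G := by
  rw [qExpansionL, qExpansionL, qExpansionL, ModularForm.coe_add,
    ModularForm.qExpansion_add one_pos (one_mem_strictPeriods_coe_gamma0 N), PowerSeries.coe_add]

/-- `qExpansionL` commutes with scalars. [folklore] -/
theorem qExpansionL_smul {k : ℤ} (c : ℂ) (F : ModularForm (Gamma0 N) k) :
    qExpansionL N (c • F) = c • qExpansionL N F := by
  rw [qExpansionL, qExpansionL, IsGLPos.coe_smul,
    ModularForm.qExpansion_smul one_pos (one_mem_strictPeriods_coe_gamma0 N), PowerSeries.coe_smul]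

/-- `qExpansionL` of a negation. [folklore] -/
theorem qExpansionL_neg {k : ℤ} (F : ModularForm (Gamma0 N) k) :
    qExpansionL N (-F) = -qExpansionL N F := by
  have : (-F : ModularForm (Gamma0 N) k) = (-1 : ℂ) • F := by ext τ; simp
  rw [this, qExpansionL_smul]
  exact neg_one_smul ℂ (qExpansionL N F)

/-- `qExpansionL 0 = 0`. [folklore] -/
@[simp]
theorem qExpansionL_zero {k : ℤ} : qExpansionL N (0 : ModularForm (Gamma0 N) k) = 0 := by
  rw [qExpansionL, ModularForm.coe_zero, qExpansion_zero, PowerSeries.coe_zero]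

/-- `qExpansionL 1 = 1`. [folklore] -/
@[simp]
theorem qExpansionL_one : qExpansionL N (1 : ModularForm (Gamma0 N) 0) = 1 := by
  rw [qExpansionL, ModularForm.qExpansion_one, PowerSeries.coe_one]

/-- `qExpansionL` ignores weight casts. [folklore] -/
@[simp]
theorem qExpansionL_mcast {a b : ℤ} (h : a = b) (F : ModularForm (Gamma0 N) a) :
    qExpansionL N (F.mcast h) = qExpansionL N F := rfl

/-- **`q`-expansion principle**: `qExpansionL F = 0 ↔ F = 0`. [folklore] -/
theorem qExpansionL_eq_zero_iff {k : ℤ} (F : ModularForm (Gamma0 N) k) :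
    qExpansionL N F = 0 ↔ F = 0 := by
  rw [qExpansionL, ← PowerSeries.coe_zero, (HahnSeries.ofPowerSeries_injective).eq_iff,
    ModularForm.qExpansion_eq_zero_iff one_pos (one_mem_strictPeriods_coe_gamma0 N)]

/-- `qExpansionL` of a power. [folklore] -/
theorem qExpansionL_pow {k : ℤ} (F : ModularForm (Gamma0 N) k) (n : ℕ) :
    qExpansionL N (F.pow n) = qExpansionL N F ^ n := by
  rw [qExpansionL, qExpansionL, ModularForm.qExpansion_pow one_pos (one_mem_strictPeriods_coe_gamma0 N),
    PowerSeries.coe_pow]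

/-- The constant modular form `1` of weight `0` is nonzero. [folklore] -/
theorem one_ne_zero_modularForm : (1 : ModularForm (Gamma0 N) 0) ≠ 0 := by
  intro h
  have := congrArg (fun f : ModularForm (Gamma0 N) 0 ↦ f UpperHalfPlane.I) h
  simp at this

/-! ### The modular function field `K_N = ℂ(X₀(N))` -/

/-- **The field of modular functions for `Γ₀(N)`**, realised inside the Laurent series field
`ℂ((q))` through `q`-expansions: the Laurent series `x` with `x · q-exp(G) = q-exp(F)` for some
modular forms `F, G ≠ 0` of the same weight for `Γ₀(N)` — i.e. the `q`-expansions of the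
meromorphic modular functions `F/G` of weight `0` (Shimura, *Introduction to the arithmetic theory
of automorphic functions*, §2.1–2.2 `A₀(Γ)`; Diamond–Shurman §7.5 `ℂ(X(Γ))`). It is an intermediate
field of `ℂ((q))/ℂ` (sums, products and inverses of such ratios are again such ratios). [folklore] -/
def modularFunctionField : IntermediateField ℂ (LaurentSeries ℂ) where
  carrier := {x | ∃ (k : ℤ) (F G : ModularForm (Gamma0 N) k), G ≠ 0 ∧ x * qExpansionL N G = qExpansionL N F}
  mul_mem' := by
    rintro x y ⟨k, F, G, hG, hx⟩ ⟨k', F', G', hG', hy⟩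
    refine ⟨k + k', F.mul F', G.mul G', ?_, ?_⟩
    · intro h
      rw [← qExpansionL_eq_zero_iff, qExpansionL_mul, mul_eq_zero, qExpansionL_eq_zero_iff,
        qExpansionL_eq_zero_iff] at h
      exact h.elim hG hG'
    · rw [qExpansionL_mul, qExpansionL_mul, ← hx, ← hy]; ring
  one_mem' := ⟨0, 1, 1, one_ne_zero_modularForm N, by simp⟩
  add_mem' := by
    rintro x y ⟨k, F, G, hG, hx⟩ ⟨k', F', G', hG', hy⟩
    refine ⟨k + k', F.mul G' + G.mul F', G.mul G', ?_, ?_⟩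
    · intro h
      rw [← qExpansionL_eq_zero_iff, qExpansionL_mul, mul_eq_zero, qExpansionL_eq_zero_iff,
        qExpansionL_eq_zero_iff] at h
      exact h.elim hG hG'
    · rw [qExpansionL_add, qExpansionL_mul, qExpansionL_mul, qExpansionL_mul, ← hx, ← hy]; ring
  zero_mem' := ⟨0, 0, 1, one_ne_zero_modularForm N, by simp⟩
  algebraMap_mem' c := by
    refine ⟨0, c • (1 : ModularForm (Gamma0 N) 0), 1, one_ne_zero_modularForm N, ?_⟩
    rw [qExpansionL_smul, qExpansionL_one, mul_one, ← HahnSeries.C_mul_eq_smul, mul_one,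
      HahnSeries.algebraMap_apply']
    simp
  inv_mem' := by
    rintro x ⟨k, F, G, hG, hx⟩
    by_cases hx0 : x = 0
    · exact ⟨0, 0, 1, one_ne_zero_modularForm N, by simp [hx0]⟩
    refine ⟨k, G, F, ?_, ?_⟩
    · intro hF
      rw [hF, qExpansionL_zero, mul_eq_zero, qExpansionL_eq_zero_iff] at hx
      exact hx.elim hx0 hG
    · rw [← hx, ← mul_assoc, inv_mul_cancel₀ hx0, one_mul]

/-- Membership in the modular function field (definitional unfolding). [folklore] -/
theorem mem_modularFunctionField_iff {x : LaurentSeries ℂ} :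
    x ∈ modularFunctionField N ↔
      ∃ (k : ℤ) (F G : ModularForm (Gamma0 N) k), G ≠ 0 ∧ x * qExpansionL N G = qExpansionL N F :=
  Iff.rfl

/-- The ratio `q-exp(F)/q-exp(G)` lies in the modular function field. [folklore] -/
theorem div_mem_modularFunctionField {k : ℤ} (F G : ModularForm (Gamma0 N) k) (hG : G ≠ 0) :
    qExpansionL N F / qExpansionL N G ∈ modularFunctionField N :=
  ⟨k, F, G, hG, div_mul_cancel₀ _ ((qExpansionL_eq_zero_iff N G).not.mpr hG)⟩

/-! ### `E₄³`, `Δ` and `j` as Laurent series -/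

/-- `E₄³` as a level-one modular form of weight `12`. [folklore] -/
def E₄cube : ModularForm 𝒮ℒ 12 := (E₄.pow 3).mcast (by norm_num)

/-- Pointwise `E₄cube τ = E₄(τ)³`. [folklore] -/
@[simp] theorem E₄cube_apply (τ : ℍ) : E₄cube τ = E₄ τ ^ 3 := by
  simp only [E₄cube, ModularForm.coe_mcast, ModularForm.coe_pow, Pi.pow_apply]

/-- `Δ` as a level-one *modular* form of weight `12`. [folklore] -/
def delta : ModularForm 𝒮ℒ 12 := ModularFormClass.modularForm CuspForm.discriminant

/-- Pointwise `delta τ = Δ(τ)`. [folklore] -/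
@[simp] theorem delta_apply (τ : ℍ) : delta τ = ModularForm.discriminant τ := rfl

/-- The constant term of `q-exp(E₄³)` is `1`. [folklore] -/
theorem constantCoeff_qExpansion_E₄cube : PowerSeries.constantCoeff (qExpansion 1 E₄cube) = 1 := by
  rw [← PowerSeries.coeff_zero_eq_constantCoeff_apply, E₄cube, ModularForm.qExpansion_mcast,
    qExpansion_coeff_zero_E₄_pow]

/-- The constant term of `q-exp(Δ)` is `0` (`Δ` is a cusp form). [folklore] -/
theorem constantCoeff_qExpansion_delta : PowerSeries.constantCoeff (qExpansion 1 delta) = 0 := by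
  rw [← PowerSeries.coeff_zero_eq_constantCoeff_apply]
  exact CuspFormClass.qExpansion_coeff_zero CuspForm.discriminant one_pos one_mem_strictPeriods_SL

/-- `q-exp(Δ) ≠ 0`. [folklore] -/
theorem qExpansion_delta_ne_zero : qExpansion 1 delta ≠ 0 := by
  rw [Ne, ModularForm.qExpansion_eq_zero_iff one_pos one_mem_strictPeriods_SL]
  intro h
  have := congrArg (fun f : ModularForm 𝒮ℒ 12 ↦ f UpperHalfPlane.I) h
  simp only [delta_apply, ModularForm.zero_apply] at this
  exact ModularForm.discriminant_ne_zero _ this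

/-- **Klein's `j` as a formal Laurent series** `j(q) = q-exp(E₄³)/q-exp(Δ) = q⁻¹ + 744 + 196884q + …`
in `ℂ((q))` (Serre VII §3.3 (22); Diamond–Shurman §1.1). [folklore] -/
def kleinJL : LaurentSeries ℂ :=
  ((qExpansion 1 E₄cube : PowerSeries ℂ) : LaurentSeries ℂ) / (qExpansion 1 delta : PowerSeries ℂ)

/-- `j ∈ K_N` for every `N`: `j = q-exp(E₄³|_{Γ₀(N)}) / q-exp(Δ|_{Γ₀(N)})`. [folklore] -/
theorem kleinJL_mem_modularFunctionField : kleinJL ∈ modularFunctionField N := by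
  have h : kleinJL = qExpansionL N (ofLevelOne (Gamma0 N) E₄cube) /
      qExpansionL N (ofLevelOne (Gamma0 N) delta) := rfl
  rw [h]
  refine div_mem_modularFunctionField N _ _ fun h0 ↦ ?_
  have := congrArg (fun f : ModularForm (Gamma0 N) 12 ↦ f UpperHalfPlane.I) h0
  simp only [coe_ofLevelOne, delta_apply, ModularForm.zero_apply] at this
  exact ModularForm.discriminant_ne_zero _ this

/-- **`j` is transcendental over `ℂ`** as a Laurent series: for a nonzero polynomial `P`,
`P(j) ≠ 0` in `ℂ((q))` (clear denominators: `q-exp(Δ)^n P(j) = ∑ p_i q-exp(E₄³)^i q-exp(Δ)^{n-i}`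
has constant term the leading coefficient `p_n ≠ 0`, `n = deg P`). [folklore] -/
theorem aeval_kleinJL_ne_zero {P : ℂ[X]} (hP : P ≠ 0) : aeval kleinJL P ≠ 0 := by
  set a : PowerSeries ℂ := qExpansion 1 E₄cube with ha
  set d : PowerSeries ℂ := qExpansion 1 delta with hd
  set n := P.natDegree with hn
  have hd0 : (d : LaurentSeries ℂ) ≠ 0 := by
    rw [Ne, ← PowerSeries.coe_zero, (HahnSeries.ofPowerSeries_injective).eq_iff]
    exact qExpansion_delta_ne_zero
  -- the cleared-denominator power series
  set T : PowerSeries ℂ := ∑ i ∈ Finset.range (n + 1), PowerSeries.C (P.coeff i) * a ^ i * d ^ (n - i)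
    with hT
  have hT0 : PowerSeries.constantCoeff T = P.coeff n := by
    rw [hT, map_sum]
    simp only [map_mul, map_pow, PowerSeries.constantCoeff_C, ha, hd,
      constantCoeff_qExpansion_E₄cube, constantCoeff_qExpansion_delta, one_pow, mul_one]
    rw [Finset.sum_eq_single n]
    · simp
    · intro i hi hin
      have : n - i ≠ 0 := by
        have := Finset.mem_range.mp hi
        omega
      simp [zero_pow this]
    · intro h; exact absurd (Finset.self_mem_range_succ n) h
  have hTne : T ≠ 0 := by
    intro h
    have : P.coeff n = 0 := by rw [← hT0, h, map_zero]
    exact hP (leadingCoeff_eq_zero.mp this)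
  -- relation `d^n · P(j) = T`
  have hrel : (d : LaurentSeries ℂ) ^ n * aeval kleinJL P = (T : LaurentSeries ℂ) := by
    have hj : kleinJL = (a : LaurentSeries ℂ) / d := rfl
    rw [aeval_eq_sum_range, Finset.mul_sum, hT,
      show ((∑ i ∈ Finset.range (n + 1), PowerSeries.C (P.coeff i) * a ^ i * d ^ (n - i) : PowerSeries ℂ) :
        LaurentSeries ℂ) = ∑ i ∈ Finset.range (n + 1),
          (((PowerSeries.C (P.coeff i) * a ^ i * d ^ (n - i) : PowerSeries ℂ)) : LaurentSeries ℂ) from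
        map_sum (HahnSeries.ofPowerSeries ℤ ℂ) _ _]
    refine Finset.sum_congr rfl fun i hi ↦ ?_
    have hin : i ≤ n := Nat.lt_succ_iff.mp (Finset.mem_range.mp hi)
    rw [PowerSeries.coe_mul, PowerSeries.coe_mul, PowerSeries.coe_pow, PowerSeries.coe_pow,
      PowerSeries.coe_C, Algebra.smul_def, HahnSeries.algebraMap_apply', PowerSeries.algebraMap_eq,
      PowerSeries.coe_C, hj, div_pow]
    rw [show (d : LaurentSeries ℂ) ^ n = (d : LaurentSeries ℂ) ^ i * (d : LaurentSeries ℂ) ^ (n - i) by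
      rw [← pow_add, Nat.add_sub_cancel' hin]]
    field_simp
  intro h0
  rw [h0, mul_zero, eq_comm, ← PowerSeries.coe_zero, (HahnSeries.ofPowerSeries_injective).eq_iff] at hrel
  exact hTne hrel

/-- `j` is transcendental over `ℂ` (as an element of `ℂ((q))`). [folklore] -/
theorem transcendental_kleinJL : Transcendental ℂ kleinJL := by
  rintro ⟨P, hP, h0⟩
  exact aeval_kleinJL_ne_zero hP h0


/-! ### Representations of modular functions -/

section Repr

variable {N}

/-- **Cross-multiplication**: two representations `x = F/G = F'/G'` of the same modular function
satisfy `F G' = G F'` as modular forms (`q`-expansion principle). [folklore] -/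
theorem mul_eq_mul_of_repr {x : LaurentSeries ℂ} {k k' : ℤ} {F G : ModularForm (Gamma0 N) k}
    {F' G' : ModularForm (Gamma0 N) k'} (h : x * qExpansionL N G = qExpansionL N F)
    (h' : x * qExpansionL N G' = qExpansionL N F') : F.mul G' = G.mul F' := by
  have hq : qExpansionL N (F.mul G') = qExpansionL N (G.mul F') := by
    rw [qExpansionL_mul, qExpansionL_mul, ← h, ← h']; ring
  have := (qExpansionL_eq_zero_iff N (F.mul G' - G.mul F')).mp (by
    rw [show F.mul G' - G.mul F' = F.mul G' + (-(G.mul F')) from sub_eq_add_neg _ _,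
      qExpansionL_add, qExpansionL_neg, hq, add_neg_cancel])
  exact sub_eq_zero.mp this

/-- A modular form of negative weight for `Γ₀(N)` vanishes, so representations have weight `≥ 0`.
[folklore] -/
theorem weight_nonneg_of_ne_zero [NeZero N] {k : ℤ} {G : ModularForm (Gamma0 N) k} (hG : G ≠ 0) :
    0 ≤ k := by
  by_contra hk
  exact hG (ModularForm.isZero_of_neg_weight (not_le.mp hk) G)

/-- **Every modular function is a ratio of forms of weight `12m`** (`m ≥ 1`): multiply numerator
and denominator of `F/G`, `F, G ∈ M_k`, by `G¹¹ Δ` (weights of nonzero forms are `≥ 0`).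
[folklore] -/
theorem exists_repr_weight_twelve_mul [NeZero N] {x : LaurentSeries ℂ} (hx : x ∈ modularFunctionField N) :
    ∃ (m : ℕ) (F G : ModularForm (Gamma0 N) (12 * ((m + 1 : ℕ) : ℤ))), G ≠ 0 ∧
      x * qExpansionL N G = qExpansionL N F := by
  obtain ⟨k, F, G, hG, h⟩ := hx
  have hk := weight_nonneg_of_ne_zero hG
  lift k to ℕ using hk
  set D : ModularForm (Gamma0 N) 12 := ofLevelOne (Gamma0 N) delta with hD
  have hD0 : D ≠ 0 := fun h0 ↦ by
    have := congrArg (fun f : ModularForm (Gamma0 N) 12 ↦ f UpperHalfPlane.I) h0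
    simp only [hD, coe_ofLevelOne, delta_apply, ModularForm.zero_apply] at this
    exact ModularForm.discriminant_ne_zero _ this
  have hw : (k : ℤ) + (11 : ℕ) * (k : ℤ) + 12 = 12 * ((k + 1 : ℕ) : ℤ) := by push_cast; ring
  refine ⟨k, ((F.mul (G.pow 11)).mul D).mcast hw, ((G.mul (G.pow 11)).mul D).mcast hw, ?_, ?_⟩
  · intro h0
    rw [← qExpansionL_eq_zero_iff, qExpansionL_mcast, qExpansionL_mul, qExpansionL_mul,
      qExpansionL_pow] at h0
    simp only [mul_eq_zero, qExpansionL_eq_zero_iff, pow_eq_zero_iff, ne_eq,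
      OfNat.ofNat_ne_zero, not_false_eq_true] at h0
    rcases h0 with (h0 | h0) | h0
    · exact hG h0
    · exact hG h0
    · exact hD0 h0
  · rw [qExpansionL_mcast, qExpansionL_mcast, qExpansionL_mul, qExpansionL_mul, qExpansionL_mul,
      qExpansionL_mul, ← h]
    ring

end Repr


/-! ### Every modular function is algebraic of degree `≤ μ` over `ℂ(j)` (Sturm count) -/

section Algebraic

variable {N}

/-- `algebraMap ℂ ℂ((q)) c` is the constant Laurent series `C c`. [folklore] -/
theorem algebraMap_laurentSeries_apply (c : ℂ) :
    algebraMap ℂ (LaurentSeries ℂ) c = HahnSeries.C c := by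
  rw [HahnSeries.algebraMap_apply', PowerSeries.algebraMap_eq, PowerSeries.coe_C]

/-- `qExpansionL` as a `ℂ`-linear map on forms of a fixed weight. [folklore] -/
def qExpansionLₗ (k : ℤ) : ModularForm (Gamma0 N) k →ₗ[ℂ] LaurentSeries ℂ where
  toFun := qExpansionL N
  map_add' := qExpansionL_add N
  map_smul' c F := by rw [qExpansionL_smul]; rfl

/-- `qExpansionLₗ` is `qExpansionL`. [folklore] -/
@[simp] theorem qExpansionLₗ_apply (k : ℤ) (F : ModularForm (Gamma0 N) k) :
    qExpansionLₗ k F = qExpansionL N F := rfl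

/-- Weight bookkeeping: `t·k + (n − t)·k = n·k` for `t ≤ n`. [folklore] -/
theorem natCast_mul_add_natCast_sub_mul {t n : ℕ} (h : t ≤ n) (k : ℤ) :
    (t : ℤ) * k + ((n - t : ℕ) : ℤ) * k = n * k := by
  rw [Nat.cast_sub h]; ring

/-- `μ = [SL₂(ℤ) : Γ₀(N)] ≥ 1`. [folklore] -/
theorem one_le_gamma0Index [NeZero N] : 1 ≤ gamma0Index N := by
  rw [← index_gamma0_eq_gamma0Index_holds N]
  exact Nat.one_le_iff_ne_zero.mpr Subgroup.index_ne_zero_of_finite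

/-- **The Sturm count.** Let `u = q-exp(F)/q-exp(G)` (`F, G ∈ M_k(Γ₀(N))`, `G ≠ 0`) and
`μ = [SL₂(ℤ) : Γ₀(N)]`. Then there are polynomials `c_0, …, c_μ ∈ ℂ[X]`, not all zero, with
`∑ᵢ cᵢ(j) uⁱ = 0` in `ℂ((q))`. Proof: for `n ≫ 0` the `(μ+1)(n+1)` forms
`E₄^{3t} Δ^{n−t} Fⁱ G^{μ−i} ∈ M_{12n + μk}(Γ₀(N))` are linearly dependent, because
`dim M_{12n+μk}(Γ₀(N)) ≤ (12n + μk)μ/12 + 1 < (μ+1)(n+1)` by Sturm's bound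
(`finiteDimensional_modularForm_gamma0`); dividing a dependency by `q-exp(Δ)ⁿ q-exp(G)^μ` gives the
relation (Shimura, *Arithmetic theory of automorphic functions*, Prop. 2.11-type degree bound
`[A₀(Γ) : ℂ(j)] ≤ μ`; Diamond–Shurman §7.5). [folklore] -/
theorem exists_polynomial_relation_kleinJL [NeZero N] {k : ℤ} (F G : ModularForm (Gamma0 N) k) (hG : G ≠ 0)
    {u : LaurentSeries ℂ} (hu : u * qExpansionL N G = qExpansionL N F) :
    ∃ c : Fin (gamma0Index N + 1) → ℂ[X], c ≠ 0 ∧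
      ∑ i, aeval kleinJL (c i) * u ^ (i : ℕ) = 0 := by
  classical
  set μ := gamma0Index N with hμ
  have hμ1 : 1 ≤ μ := one_le_gamma0Index
  set n : ℕ := (μ ^ 2 * k).toNat with hn
  -- the level-`N` copies of `E₄³` and `Δ`
  set A : ModularForm (Gamma0 N) 12 := ofLevelOne (Gamma0 N) E₄cube with hA
  set D : ModularForm (Gamma0 N) 12 := ofLevelOne (Gamma0 N) delta with hD
  -- the forms `B (i, t) = E₄^{3t} Δ^{n-t} F^i G^{μ-i}` of weight `12 n + μ k`
  let Bform : Fin (μ + 1) × Fin (n + 1) → ModularForm (Gamma0 N) ((n : ℤ) * 12 + (μ : ℤ) * k) :=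
    fun p ↦ (((A.pow p.2).mul (D.pow (n - p.2))).mcast
        (natCast_mul_add_natCast_sub_mul (Nat.lt_succ_iff.mp p.2.isLt) 12)).mul
      (((F.pow p.1).mul (G.pow (μ - p.1))).mcast
        (natCast_mul_add_natCast_sub_mul (Nat.lt_succ_iff.mp p.1.isLt) k))
  -- dimension count
  obtain ⟨hfin, hdim⟩ := finiteDimensional_modularForm_gamma0 N ((n : ℤ) * 12 + (μ : ℤ) * k)
  haveI := hfin
  let Φ : (Fin (μ + 1) × Fin (n + 1) → ℂ) →ₗ[ℂ] ModularForm (Gamma0 N) ((n : ℤ) * 12 + (μ : ℤ) * k) :=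
    Fintype.linearCombination ℂ Bform
  have hlt : Module.finrank ℂ (ModularForm (Gamma0 N) ((n : ℤ) * 12 + (μ : ℤ) * k)) <
      Module.finrank ℂ (Fin (μ + 1) × Fin (n + 1) → ℂ) := by
    rw [Module.finrank_pi, Fintype.card_prod, Fintype.card_fin, Fintype.card_fin]
    refine lt_of_le_of_lt hdim ?_
    rw [← hμ]
    have h1 : (((n : ℤ) * 12 + (μ : ℤ) * k) * μ).toNat ≤ 12 * (n * μ) + (μ ^ 2 * k).toNat := by
      have : ((n : ℤ) * 12 + (μ : ℤ) * k) * μ = ((12 * (n * μ) : ℕ) : ℤ) + μ ^ 2 * k := by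
        push_cast; ring
      rw [this, Int.toNat_le]
      push_cast
      linarith [Int.self_le_toNat ((μ : ℤ) ^ 2 * k)]
    have h2 : (((n : ℤ) * 12 + (μ : ℤ) * k) * μ).toNat / 12 ≤ n * μ + (μ ^ 2 * k).toNat / 12 := by
      refine (Nat.div_le_div_right h1).trans ?_
      rw [Nat.mul_add_div (by norm_num)]
    have h3 : (μ ^ 2 * k).toNat / 12 ≤ n := by rw [hn]; exact Nat.div_le_self _ _
    nlinarith
  obtain ⟨r, hrker, hr0⟩ : ∃ r ∈ LinearMap.ker Φ, r ≠ 0 :=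
    Submodule.exists_mem_ne_zero_of_ne_bot (LinearMap.ker_ne_bot_of_finrank_lt hlt)
  -- the polynomials `c_i = ∑_t r(i,t) X^t`
  refine ⟨fun i ↦ ∑ t : Fin (n + 1), monomial (t : ℕ) (r (i, t)), ?_, ?_⟩
  · -- not all zero
    intro hc
    apply hr0
    funext ⟨i, t⟩
    have hi := congrFun hc i
    simp only [Pi.zero_apply] at hi
    have := congrArg (fun P : ℂ[X] ↦ P.coeff t) hi
    simp only [finsetSum_coeff, coeff_monomial, coeff_zero] at this
    rw [Finset.sum_eq_single t] at this
    · simpa using this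
    · intro b _ hb
      rw [if_neg]
      exact fun h ↦ hb (Fin.ext h)
    · intro h; exact absurd (Finset.mem_univ t) h
  · -- the relation, from `∑ r • B = 0` divided by `q-exp(Δ)^n q-exp(G)^μ`
    have hΦ : ∑ p, r p • Bform p = 0 := by
      simpa [Φ, Fintype.linearCombination_apply] using hrker
    -- apply `qExpansionL`
    set a := qExpansionL N A with ha
    set d := qExpansionL N D with hd'
    set f := qExpansionL N F with hf
    set g := qExpansionL N G with hg
    have hd0 : d ≠ 0 := by
      rw [hd', Ne, qExpansionL_eq_zero_iff]
      intro h0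
      have := congrArg (fun f : ModularForm (Gamma0 N) 12 ↦ f UpperHalfPlane.I) h0
      simp only [hD, coe_ofLevelOne, delta_apply, ModularForm.zero_apply] at this
      exact ModularForm.discriminant_ne_zero _ this
    have hg0 : g ≠ 0 := by rwa [hg, Ne, qExpansionL_eq_zero_iff]
    have hj : kleinJL = a / d := rfl
    have huf : u = f / g := by rw [eq_div_iff hg0, hf, hg, hu]
    have hqB : ∀ p : Fin (μ + 1) × Fin (n + 1), qExpansionL N (Bform p) =
        a ^ (p.2 : ℕ) * d ^ (n - p.2) * (f ^ (p.1 : ℕ) * g ^ (μ - p.1)) := by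
      intro p
      simp only [Bform, qExpansionL_mul, qExpansionL_mcast, qExpansionL_pow, ha, hd', hf, hg]
    have hsum : ∑ p : Fin (μ + 1) × Fin (n + 1),
        HahnSeries.C (r p) * (a ^ (p.2 : ℕ) * d ^ (n - p.2) * (f ^ (p.1 : ℕ) * g ^ (μ - p.1))) = 0 := by
      have := congrArg (qExpansionLₗ ((n : ℤ) * 12 + (μ : ℤ) * k)) hΦ
      rw [map_sum, map_zero] at this
      rw [← this]
      refine Finset.sum_congr rfl fun p _ ↦ ?_
      rw [qExpansionLₗ_apply, qExpansionL_smul, ← HahnSeries.C_mul_eq_smul, hqB]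
    -- each term equals `C(r) · j^t u^i · (d^n g^μ)`
    have hterm : ∀ p : Fin (μ + 1) × Fin (n + 1),
        HahnSeries.C (r p) * (a ^ (p.2 : ℕ) * d ^ (n - p.2) * (f ^ (p.1 : ℕ) * g ^ (μ - p.1))) =
          (HahnSeries.C (r p) * (kleinJL ^ (p.2 : ℕ) * u ^ (p.1 : ℕ))) * (d ^ n * g ^ μ) := by
      rintro ⟨i, t⟩
      have hi : (i : ℕ) ≤ μ := Nat.lt_succ_iff.mp i.isLt
      have ht : (t : ℕ) ≤ n := Nat.lt_succ_iff.mp t.isLt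
      have hdn : d ^ n = d ^ (t : ℕ) * d ^ (n - t) := by rw [← pow_add, Nat.add_sub_cancel' ht]
      have hgμ : g ^ μ = g ^ (i : ℕ) * g ^ (μ - i) := by rw [← pow_add, Nat.add_sub_cancel' hi]
      conv_rhs => rw [hj, huf, hdn, hgμ, div_pow, div_pow]
      simp only
      field_simp
    have hsum' : (∑ p : Fin (μ + 1) × Fin (n + 1),
        HahnSeries.C (r p) * (kleinJL ^ (p.2 : ℕ) * u ^ (p.1 : ℕ))) * (d ^ n * g ^ μ) = 0 := by
      rw [Finset.sum_mul]
      simpa only [hterm] using hsum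
    have hsum'' : ∑ p : Fin (μ + 1) × Fin (n + 1),
        HahnSeries.C (r p) * (kleinJL ^ (p.2 : ℕ) * u ^ (p.1 : ℕ)) = 0 := by
      rcases mul_eq_zero.mp hsum' with h | h
      · exact h
      · exact absurd h (mul_ne_zero (pow_ne_zero _ hd0) (pow_ne_zero _ hg0))
    -- regroup by `i`
    rw [← hsum'', Fintype.sum_prod_type]
    refine Finset.sum_congr rfl fun i _ ↦ ?_
    rw [map_sum, Finset.sum_mul]
    refine Finset.sum_congr rfl fun t _ ↦ ?_
    rw [aeval_monomial, algebraMap_laurentSeries_apply, mul_assoc]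

end Algebraic




/-! ### Bounded degree and a primitive element -/

section BoundedDegree

/-- **A separable algebraic extension with bounded degrees is finite and simple**: if every
element of `E` has degree `≤ n` over an infinite field `K` (with `E/K` separable), then
`E = K(u₀)` for any `u₀` of maximal degree (primitive element theorem applied to `K(u₀, w)`).
[folklore] -/
theorem exists_adjoin_simple_eq_top_of_natDegree_le {K E : Type*} [Field K] [Field E] [Algebra K E]
    [Infinite K] [Algebra.IsSeparable K E] (n : ℕ) (h : ∀ u : E, (minpoly K u).natDegree ≤ n) :
    ∃ u₀ : E, K⟮u₀⟯ = ⊤ := by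
  classical
  set d : E → ℕ := fun u ↦ (minpoly K u).natDegree with hd
  set m := Nat.findGreatest (fun i ↦ ∃ u : E, d u = i) n with hm
  have hex : ∃ u₀ : E, d u₀ = m :=
    Nat.findGreatest_spec (P := fun i ↦ ∃ u : E, d u = i) (h 0) ⟨0, rfl⟩
  obtain ⟨u₀, hu₀⟩ := hex
  have hmax : ∀ w : E, d w ≤ m := fun w ↦
    Nat.le_findGreatest (P := fun i ↦ ∃ u : E, d u = i) (h w) ⟨w, rfl⟩
  have hfr : ∀ u : E, Module.finrank K K⟮u⟯ = d u := fun u ↦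
    IntermediateField.adjoin.finrank (Algebra.IsSeparable.isIntegral K u)
  refine ⟨u₀, eq_top_iff.mpr fun w _ ↦ ?_⟩
  obtain ⟨γ, hγ⟩ := Field.primitive_element_inf_aux K (E := E) (α := u₀) (β := w)
  have hle : K⟮u₀⟯ ≤ K⟮γ⟯ := by
    rw [← hγ]
    exact IntermediateField.adjoin.mono _ _ _ (Set.singleton_subset_iff.mpr (Set.mem_insert _ _))
  haveI : FiniteDimensional K K⟮γ⟯ :=
    IntermediateField.adjoin.finiteDimensional (Algebra.IsSeparable.isIntegral K γ)
  have heq : K⟮u₀⟯ = K⟮γ⟯ := by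
    refine IntermediateField.eq_of_le_of_finrank_le hle ?_
    rw [hfr, hfr, hu₀]
    exact hmax γ
  rw [heq, ← hγ]
  exact IntermediateField.subset_adjoin K _ (Set.mem_insert_of_mem _ rfl)

end BoundedDegree

/-! ### `K_N/ℂ` is an algebraic function field of one variable -/

section FunctionField

variable {N}

/-- `j` as an element of the modular function field `K_N`. [folklore] -/
def kleinJK (N : ℕ) : modularFunctionField N := ⟨kleinJL, kleinJL_mem_modularFunctionField N⟩

/-- `(kleinJK N : ℂ((q))) = kleinJL`. [folklore] -/
@[simp] theorem coe_kleinJK : ((kleinJK N : modularFunctionField N) : LaurentSeries ℂ) = kleinJL := rfl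

/-- `j ∈ K_N` is transcendental over `ℂ`. [folklore] -/
theorem transcendental_kleinJK : Transcendental ℂ (kleinJK N) := by
  intro h
  exact transcendental_kleinJL (h.algHom (IntermediateField.val (modularFunctionField N)))

/-- **Every modular function satisfies a polynomial of degree `≤ μ` over `ℂ[j]`**: for `u ∈ K_N`
there is `Q ∈ ℂ[X][Y]`, `Q ≠ 0`, `deg_Y Q ≤ μ = [SL₂(ℤ) : Γ₀(N)]`, with `Q(j, u) = 0`
(Shimura 1971, Prop. 2.11 / §2.2; Diamond–Shurman §7.5). [folklore] -/
theorem exists_aeval_aeval_kleinJK_eq_zero [NeZero N] (u : modularFunctionField N) :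
    ∃ Q : Polynomial ℂ[X], Q ≠ 0 ∧ Q.natDegree ≤ gamma0Index N ∧
      (Q.map (aeval (kleinJK N)).toRingHom).aeval u = 0 := by
  classical
  obtain ⟨k, F, G, hG, hu⟩ := u.2
  obtain ⟨c, hc0, hrel⟩ := exists_polynomial_relation_kleinJL F G hG hu
  refine ⟨∑ i : Fin (gamma0Index N + 1), monomial (i : ℕ) (c i), ?_, ?_, ?_⟩
  · intro h0
    apply hc0
    funext i
    have := congrArg (fun P : Polynomial ℂ[X] ↦ P.coeff i) h0
    simp only [finsetSum_coeff, coeff_monomial, coeff_zero] at this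
    rw [Finset.sum_eq_single i] at this
    · simpa using this
    · intro b _ hb; rw [if_neg]; exact fun h ↦ hb (Fin.ext h)
    · intro h; exact absurd (Finset.mem_univ i) h
  · refine natDegree_sum_le_of_forall_le _ _ fun i _ ↦ ?_
    exact (natDegree_monomial_le _).trans (Nat.lt_succ_iff.mp i.isLt)
  · apply Subtype.val_injective
    change ((aeval u (Polynomial.map (aeval (kleinJK N)).toRingHom
      (∑ i : Fin (gamma0Index N + 1), monomial (i : ℕ) (c i)))) : LaurentSeries ℂ) = 0
    rw [← hrel, Polynomial.map_sum, map_sum]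
    rw [show ((∑ i : Fin (gamma0Index N + 1), aeval u (Polynomial.map (aeval (kleinJK N)).toRingHom
        (monomial (i : ℕ) (c i))) : modularFunctionField N) : LaurentSeries ℂ) =
        ∑ i : Fin (gamma0Index N + 1), ((aeval u (Polynomial.map (aeval (kleinJK N)).toRingHom
        (monomial (i : ℕ) (c i))) : modularFunctionField N) : LaurentSeries ℂ) from
      map_sum (IntermediateField.val (modularFunctionField N)) _ _]
    refine Finset.sum_congr rfl fun i _ ↦ ?_
    rw [Polynomial.map_monomial, aeval_monomial]
    change ((((aeval (kleinJK N)).toRingHom (c i) : modularFunctionField N) * u ^ (i : ℕ) :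
      modularFunctionField N) : LaurentSeries ℂ) = _
    rw [MulMemClass.coe_mul, SubmonoidClass.coe_pow]
    congr 1
    change ((aeval (kleinJK N) (c i) : modularFunctionField N) : LaurentSeries ℂ) = aeval kleinJL (c i)
    rw [← coe_kleinJK, ← IntermediateField.coe_val, ← aeval_algHom_apply]

/-- The `ℂ[X]`-algebra structure `X ↦ j` on `K_N` (local instance for the transcendence degree).
[folklore] -/
@[reducible]
def polynomialAlgebra (N : ℕ) : Algebra ℂ[X] (modularFunctionField N) :=
  (aeval (kleinJK N) : ℂ[X] →ₐ[ℂ] modularFunctionField N).toRingHom.toAlgebra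

attribute [local instance] polynomialAlgebra

/-- The structure map `ℂ[X] → K_N` is `p ↦ p(j)`. [folklore] -/
theorem algebraMap_polynomial_apply (p : ℂ[X]) :
    algebraMap ℂ[X] (modularFunctionField N) p = aeval (kleinJK N) p := rfl

/-- `ℂ → ℂ[X] → K_N` is a scalar tower. [folklore] -/
theorem isScalarTower_polynomial : IsScalarTower ℂ ℂ[X] (modularFunctionField N) :=
  IsScalarTower.of_algebraMap_eq fun c ↦ by
    rw [algebraMap_polynomial_apply, Polynomial.algebraMap_apply, aeval_C, Algebra.algebraMap_self,
      RingHom.id_apply]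

attribute [local instance] isScalarTower_polynomial

/-- `ℂ[X] → K_N` is injective (`j` is transcendental). [folklore] -/
theorem faithfulSMul_polynomial : FaithfulSMul ℂ[X] (modularFunctionField N) := by
  rw [faithfulSMul_iff_algebraMap_injective]
  exact transcendental_iff_injective.mp transcendental_kleinJK

attribute [local instance] faithfulSMul_polynomial

/-- `K_N` is algebraic over `ℂ[j]`. [folklore] -/
theorem isAlgebraic_polynomial [NeZero N] : Algebra.IsAlgebraic ℂ[X] (modularFunctionField N) := by
  refine ⟨fun u ↦ ?_⟩
  obtain ⟨Q, hQ0, -, hQu⟩ := exists_aeval_aeval_kleinJK_eq_zero u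
  refine ⟨Q, hQ0, ?_⟩
  rwa [← aeval_map_algebraMap (modularFunctionField N), show algebraMap ℂ[X] (modularFunctionField N) =
    (aeval (kleinJK N)).toRingHom from rfl]

/-- **`trdeg_ℂ K_N = 1`** (`{j}` is a transcendence basis: `j` is transcendental and `K_N/ℂ(j)` is
algebraic). [folklore] -/
theorem trdeg_modularFunctionField [NeZero N] : Algebra.trdeg ℂ (modularFunctionField N) = 1 := by
  haveI := isAlgebraic_polynomial (N := N)
  have h := trdeg_add_eq ℂ ℂ[X] (A := modularFunctionField N)
  rwa [Polynomial.trdeg_of_isDomain, trdeg_eq_zero, add_zero, eq_comm] at h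

/-- The subfield `ℂ(j) ≤ K_N` generated by `j`. [folklore] -/
abbrev ratFuncJ (N : ℕ) : IntermediateField ℂ (modularFunctionField N) := ℂ⟮kleinJK N⟯

/-- `K_N` is algebraic over `ℂ(j)`, every element having degree `≤ μ`. [folklore] -/
theorem natDegree_minpoly_ratFuncJ_le [NeZero N] (u : modularFunctionField N) :
    IsAlgebraic (ratFuncJ N) u ∧ (minpoly (ratFuncJ N) u).natDegree ≤ gamma0Index N := by
  obtain ⟨Q, hQ0, hQdeg, hQu⟩ := exists_aeval_aeval_kleinJK_eq_zero u
  -- push the coefficients into `ℂ(j)`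
  set jK : ratFuncJ N := ⟨kleinJK N, IntermediateField.mem_adjoin_simple_self ℂ _⟩ with hjK
  set φ : ℂ[X] →+* ratFuncJ N := (aeval jK : ℂ[X] →ₐ[ℂ] ratFuncJ N).toRingHom with hφ
  have hφinj : Function.Injective φ := by
    have ht : Transcendental ℂ jK := fun h ↦
      transcendental_kleinJK (N := N) (h.algHom (IntermediateField.val (ratFuncJ N)))
    exact transcendental_iff_injective.mp ht
  have hcomp : (algebraMap (ratFuncJ N) (modularFunctionField N)).comp φ =
      (aeval (kleinJK N)).toRingHom := by
    ext p
    · simp [hφ]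
    · simp [hφ, hjK]
  set QK : Polynomial (ratFuncJ N) := Q.map φ with hQK
  have hQK0 : QK ≠ 0 := by
    rwa [hQK, Ne, Polynomial.map_eq_zero_iff hφinj]
  have hQKu : aeval u QK = 0 := by
    rw [hQK, ← aeval_map_algebraMap (modularFunctionField N), Polynomial.map_map, hcomp]
    exact hQu
  have hdegK : QK.natDegree ≤ gamma0Index N := (natDegree_map_le).trans hQdeg
  refine ⟨⟨QK, hQK0, hQKu⟩, ?_⟩
  have := minpoly.degree_le_of_ne_zero (ratFuncJ N) u hQK0 hQKu
  exact (natDegree_le_natDegree this).trans hdegK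

/-- `K_N/ℂ(j)` is algebraic. [folklore] -/
instance isAlgebraic_ratFuncJ [NeZero N] : Algebra.IsAlgebraic (ratFuncJ N) (modularFunctionField N) :=
  ⟨fun u ↦ (natDegree_minpoly_ratFuncJ_le u).1⟩

/-- **`K_N = ℂ(j, u₀)` for a primitive element `u₀`; `[K_N : ℂ(j)] ≤ μ`-type finiteness**
(Shimura 1971, Prop. 2.11; Diamond–Shurman §7.5: `ℂ(X₀(N)) = ℂ(j, f)`). [folklore] -/
theorem exists_ratFuncJ_adjoin_eq_top [NeZero N] :
    ∃ u₀ : modularFunctionField N, (ratFuncJ N)⟮u₀⟯ = ⊤ :=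
  exists_adjoin_simple_eq_top_of_natDegree_le (gamma0Index N)
    fun u ↦ (natDegree_minpoly_ratFuncJ_le u).2

/-- **`K_N/ℂ` is an algebraic function field of one variable** (Stichtenoth Def. 1.1.1):
`trdeg_ℂ K_N = 1` and `K_N = ℂ(j, u₀)` is finitely generated (Shimura 1971, §2.1–2.2;
Diamond–Shurman §7.5). No Mathlib or tree instance for this type exists. [folklore] -/
instance isAlgFunctionField_modularFunctionField [NeZero N] :
    DiophantineGeometry.IsAlgFunctionField ℂ (modularFunctionField N) where
  trdeg_eq_one := trdeg_modularFunctionField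
  fg_top := by
    classical
    obtain ⟨u₀, hu₀⟩ := exists_ratFuncJ_adjoin_eq_top (N := N)
    refine ⟨{kleinJK N, u₀}, ?_⟩
    rw [Finset.coe_insert, Finset.coe_singleton, ← IntermediateField.adjoin_simple_adjoin_simple,
      hu₀, IntermediateField.restrictScalars_top]

/-- **`ℂ` is the full constant field of `K_N`**: an element of `K_N` integral over `ℂ` lies in
`ℂ` (`ℂ` is algebraically closed). [folklore] -/
instance isIntegrallyClosedIn_modularFunctionField :
    IsIntegrallyClosedIn ℂ (modularFunctionField N) := by
  refine (isIntegrallyClosedIn_iff).mpr ⟨(algebraMap ℂ (modularFunctionField N)).injective, fun {x} hx ↦ ?_⟩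
  have h1 : (minpoly ℂ x).degree = 1 :=
    IsAlgClosed.degree_eq_one_of_irreducible ℂ (minpoly.irreducible hx)
  have hmonic := minpoly.monic hx
  have hform := Polynomial.eq_X_add_C_of_degree_eq_one h1
  rw [hmonic.leadingCoeff, map_one, one_mul] at hform
  have h0 := minpoly.aeval ℂ x
  rw [hform, map_add, aeval_X, aeval_C] at h0
  refine ⟨-(minpoly ℂ x).coeff 0, ?_⟩
  rw [map_neg]
  linear_combination -h0

end FunctionField

end Literature.NumberTheory.EllipticCurves.ModularForms

end
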